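import Literature.AnabelianGeometry.EtaleTheta.SettingModelChiInversionTheta
import HarnessLib

/-!
# The choice `X̲̲` at the χ-models: census clauses of [EtTh] Def. 2.5 (i)(b) — `Π^tp_X̲̲` is NOT normal in `Π^tp_X`,
# but it IS stable under the inversion and meets the cusp's decomposition group over all of `G_K` (proof-only)

Mochizuki, *The étale theta function …*, Publ. RIMS **45** (2009) [EtTh], Def. 2.5 (i) p. 39: "`X̲̲ → X` … determined …
by the choice of a splitting of `D_x → G_K` … compatible with the `{±1}`-structure", Def. 2.7 p. 41
[cite: MochizukiEtTh2009, Def 2.5 (i) p.39].  abc-iut cell, layer L2, prover abc-iut-L2-d1 (gen 5); PROOF-ONLY input to the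
13:00Z v-next census item C10 (drafter abc-iut-L2-t3: «`EtaleThetaData.DoubleUnderline` carries no ι-stability»; proposed
clauses `inv_stable : ∀ g : Π^tp_C, conj_g-stability` and `map_aug_Dx_inf_Huu`), answered AT THE CONSTRUCTOR SITES
(this seat's `Huuχ p l := dUU l ⋊_χ G_{ℚ_p}` over abc-iut-L2-t1's `modelχ` and abc-iut-w5-d029's cusped `modelχ′`):

* **`not_normal_Huuχ`** — for `l > 1`, `Π^tp_X̲̲` is NOT normal in `Π^tp_X` (`inl b ∈ Π^tp_X̲̲`, but
  `inl a · inl b · (inl a)⁻¹` has level-`l` shadow `(0, 1, 1)`, `z_l = 1 ≠ 0`): the drafted ∀-over-`Π^tp_C` clause is FALSE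
  at the site — as in print, where `X̲̲ → X̲` is the non-Galois degree-`l` covering cut out by a cocycle zero set;
* `map_Huuχ_twistedInversion` (imported, `SettingModelChiInversionTheta`) — the `{±1}`-clause that DOES hold:
  `ι(Π^tp_X̲̲) = Π^tp_X̲̲` for the twisted inversion;
* **`map_aug_decomp_inf_Huuχ_modelχ'`** — at the cusped model the decomposition group `D_x = b^Ẑ ⋊ G_{ℚ_p}` of the cusp
  meets `Π^tp_X̲̲` in a subgroup mapping ONTO `G_K` (the Galois section `inr` lies in both): the clause
  «`(decomp x ⊓ Huu).map aug = GK`» HOLDS at `modelχ′` (and is vacuous at `modelχ`, whose `Pt` is empty).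
Recommended census reading: C10 = {ι-stability w.r.t. the inversion datum, cusp-section clause}, both kernel-true at every
χ-model constructor site.  SEMI-SYNTHETIC MODELS, consistency evidence only; nothing of [EtTh] asserted; no side taken on
[IUTchIII] Cor. 3.12.
-/

noncomputable section

namespace Literature.AnabelianGeometry.EtaleTheta.SettingModel

open Literature.AnabelianGeometry.SemiGraphs _root_.Function

variable (p : ℕ) [Fact p.Prime]

/-! ### `Π^tp_X̲̲` is not normal in `Π^tp_X` -/

/-- `inl (η b, 0) ∈ Π^tp_X̲̲`: the loop `b` has level `(0, 1, 0)`. [cite: MochizukiEtTh2009, Def 2.5 (i) p.39] -/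
theorem inl_gfpOf_of_one_mem_Huuχ (l : ℕ+) :
    (SemidirectProduct.inl (gfpOf (FreeGroup.of 1)) : PiTpχ p) ∈ Huuχ p l := by
  rw [inl_mem_Huuχ_iff, mem_dUU_iff, levelHom_gfpOf, heisHom_of_one, Heis.map_apply]
  exact ⟨by simp, by simp⟩

/-- `inl (η a, 1) · inl (η b, 0) · (inl (η a, 1))⁻¹ = inl (η(a b a⁻¹), 0)` has level-`l` shadow `(0, 1, 1)` — its
`z`-coordinate is `1`. [cite: MochizukiEtTh2009, Def 2.5 (i) p.39] -/
theorem levelHom_conj_gfpOf_of_one_z (l : ℕ+) :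
    (levelHom l (gfpOf (FreeGroup.of 0) * gfpOf (FreeGroup.of 1) * (gfpOf (FreeGroup.of 0))⁻¹)).z = 1 := by
  rw [map_mul, map_mul, map_inv, levelHom_gfpOf, levelHom_gfpOf, heisHom_of_zero, heisHom_of_one]
  simp

/-- **`Π^tp_X̲̲` is NOT normal in `Π^tp_X`** (for `l > 1`): conjugating `inl b ∈ Π^tp_X̲̲` by `inl a` yields level
`(0, 1, 1) ∉ {x = 0, z = 0}` — the degree-`l` covering `X̲̲ → X̲ → X` is not Galois (the census clause «∀ g ∈ Π^tp_C,
conj_g-stability of Π^tp_X̲̲» is false at the constructor site, as in print). [cite: MochizukiEtTh2009, Def 2.5 (i) p.39] -/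
theorem not_normal_Huuχ (l : ℕ+) (hl : 1 < (l : ℕ)) : ¬ (Huuχ p l).Normal := by
  intro hN
  have hb := inl_gfpOf_of_one_mem_Huuχ p l
  have hconj := hN.conj_mem _ hb (SemidirectProduct.inl (gfpOf (FreeGroup.of 0)))
  rw [← map_inv, ← map_mul, ← map_mul, inl_mem_Huuχ_iff, mem_dUU_iff] at hconj
  have hz := hconj.2
  rw [levelHom_conj_gfpOf_of_one_z] at hz
  haveI : Fact (1 < (l : ℕ)) := ⟨hl⟩
  exact one_ne_zero hz

/-- The record-level form: `Π^tp_X̲̲` of the choice `doubleUnderlineχSec` is not normal in `Π^tp_X` (`l > 1`).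
[cite: MochizukiEtTh2009, Def 2.5 (i) p.39] -/
theorem not_normal_Huu_doubleUnderlineχSec (l : ℕ+) (hl : Odd (l : ℕ)) (hl1 : 1 < (l : ℕ)) :
    ¬ (doubleUnderlineχSec p l hl).Huu.Normal :=
  not_normal_Huuχ p l hl1

/-! ### The cusp-section clause at the cusped χ-model -/

/-- `inr σ ∈ D_x = b^Ẑ ⋊ G_{ℚ_p}` (`1 ∈ b^Ẑ`). [cite: MochizukiEtTh2009, Def 2.5 (i) p.39] -/
theorem inr_mem_cuspDecompχ (σ : GQp p) : (SemidirectProduct.inr σ : PiTpχ p) ∈ cuspDecompχ p := by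
  rw [mem_cuspDecompχ_iff, SemidirectProduct.left_inr]
  exact Subgroup.one_mem _

/-- **Def. 2.5 (i)(b) at the cusped χ-model**: the decomposition group of the (unique) cusp of `modelχ′` meets `Π^tp_X̲̲` in a
subgroup mapping onto `G_K` — «`X̲̲ → X` is determined by a splitting of `D_x ↠ G_K`» holds for `X̲̲ := Huuχ p l` with the
Galois section `inr`. [cite: MochizukiEtTh2009, Def 2.5 (i) p.39] -/
theorem map_aug_decomp_inf_Huuχ_modelχ' (l : ℕ+) (x : (ThetaSetting.modelχ' p).Pt) :
    ((ThetaSetting.modelχ' p).decomp x ⊓ Huuχ p l).map (ThetaSetting.modelχ' p).aug.toMonoidHom =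
      (ThetaSetting.modelχ' p).GK := by
  have hGK : (ThetaSetting.modelχ' p).GK = ⊤ := IntermediateField.fixingSubgroup_bot
  rw [hGK]
  refine eq_top_iff.mpr fun σ _ => ?_
  exact ⟨SemidirectProduct.inr σ, Subgroup.mem_inf.mpr ⟨inr_mem_cuspDecompχ p σ, inr_mem_Huuχ p l σ⟩, rfl⟩

/-- The same for `Π^tp_Ÿ ∩ Π^tp_X̲̲ ∩ D_x` (the splitting lands in `Π^tp_Ÿ̲̲ = Π^tp_Ÿ ∩ Π^tp_X̲̲` as well).
[cite: MochizukiEtTh2009, Def 2.7 p.41] -/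
theorem map_aug_decomp_inf_GtpYdd_inf_Huuχ_modelχ' (l : ℕ+) (x : (ThetaSetting.modelχ' p).Pt) :
    ((ThetaSetting.modelχ' p).decomp x ⊓ ((ThetaSetting.modelχ' p).GtpYdd ⊓ Huuχ p l)).map
        (ThetaSetting.modelχ' p).aug.toMonoidHom = (ThetaSetting.modelχ' p).GK := by
  have hGK : (ThetaSetting.modelχ' p).GK = ⊤ := IntermediateField.fixingSubgroup_bot
  have hYdd : (ThetaSetting.modelχ' p).GtpYdd = (ThetaSetting.modelχ p).GtpYdd := rfl
  rw [hGK, hYdd, GtpYdd_modelχ]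
  refine eq_top_iff.mpr fun σ _ => ?_
  exact ⟨SemidirectProduct.inr σ, Subgroup.mem_inf.mpr ⟨inr_mem_cuspDecompχ p σ,
    Subgroup.mem_inf.mpr ⟨inr_mem_YNχ_two p σ, inr_mem_Huuχ p l σ⟩⟩, rfl⟩

/-- **C10 at the χ-model constructor sites, summarised**: `Π^tp_X̲̲` is ι-stable for the twisted inversion, meets the
cusp's decomposition group over all of `G_K` at the cusped model, and is NOT normal in `Π^tp_X` (`l > 1`).
[cite: MochizukiEtTh2009, Def 2.5 (i) p.39] -/
theorem doubleUnderline_census_modelχ (l : ℕ+) (hl : 1 < (l : ℕ)) :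
    (Huuχ p l).map (twistedInversionTop (chi p) (isInducing_leftRightχ p)).toMulEquiv.toMonoidHom = Huuχ p l ∧
      (∀ x : (ThetaSetting.modelχ' p).Pt,
        ((ThetaSetting.modelχ' p).decomp x ⊓ Huuχ p l).map (ThetaSetting.modelχ' p).aug.toMonoidHom =
          (ThetaSetting.modelχ' p).GK) ∧
      ¬ (Huuχ p l).Normal :=
  ⟨map_Huuχ_twistedInversion p l, map_aug_decomp_inf_Huuχ_modelχ' p l, not_normal_Huuχ p l hl⟩

end Literature.AnabelianGeometry.EtaleTheta.SettingModel

end
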